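import Summits.CriticalPhenomena.Ising3D.TaylorTableHeadDeltaRowsS
import Summits.CriticalPhenomena.Ising3D.TaylorRegionDeltaRowsSPieces
import Mathlib.Tactic.Linarith
import Mathlib.Tactic.Positivity
import Mathlib.Tactic.Ring
import HarnessLib

/-!
# Head-row contracts from S-format literal δ-tables with the PIECEWISE second-order slot (T2′ (a′), lead RULING R26-κ)
(cell `pub-ising3x`, seat boot-1 gen 19, 2026-08-24; companion of `TaylorRegionDeltaRowsSPieces`)

HONEST FRAMING: lottery ticket; floor = tightest certified 3D Ising CFT bounds; no exact-solution
claim without a proof. Island framing: certified exclusion region at stated derivative order and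
assumptions; not a determination of the 3D Ising critical exponents beyond that.

`OddHeadRowsΔ.validΔ_of_litSP` / `HeadRowsΔ.validΔ_of_litSP` = `validΔ_of_litS` (TaylorTableHeadDeltaRowsS) VERBATIM except that the slot-2
δ-table containment of every component is taken PIECEWISE, ONE KERNEL TABLE PER DECISION: `d.tabOKcS TT c m` for the slots `m < 2` only, plus
`d.kpieceOKcS PL c i` (i < 13: computed kernel table `Km … i` ⊆ literal `PL_c[i]`) and `d.ksumOKcS TT PL c` (`combineS` of the literals ⊆ the slot-2
literal; literals only). The contracts `ValidΔ` and everything downstream are UNCHANGED. [folklore]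
-/

namespace Summit.CriticalPhenomena.Ising3D

open Finset Set
open Literature.Analysis.ValidatedNumerics Literature.Analysis.ValidatedNumerics.PolyMP
open Literature.Analysis.ValidatedNumerics.NumericsMP (MI)
open Literature.MathematicalPhysics.QuantumFieldTheory.ConformalBootstrap3D

/-! ### Odd sector -/

namespace OddConeRegionDataΔ

variable (d : OddConeRegionDataΔ)

/-- Containment of the computed kernel table `i` of component `c` in its literal (S-format, piecewise slot 2; ONE table per decision). [folklore] -/
def kpieceOKcS (PL : IPieceL5) (c i : ℕ) : Bool :=
  kpieceOKS d.S (d.compC c) (OddConeRegionDataΔ.compσ c) (d.comps₀ c) (d.compW c) d.ccQ (d.compL c) (proj5 PL c) i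

/-- Literal-only containment of component `c`: `combineS` of its thirteen literals ⊆ its slot-2 literal. [folklore] -/
def ksumOKcS (TT : ITab3x5) (PL : IPieceL5) (c : ℕ) : Bool := ksumOKS d.S (d.compW c) (proj5 PL c) (proj5 TT c)

end OddConeRegionDataΔ

namespace OddHeadRowsΔ

/-- **`ValidΔ` from literal δ-tables, S-format, PIECEWISE slot 2** (= `validΔ_of_litS` with `hT` restricted to slots 0, 1 and the slot-2
containments supplied as pieces `hP` + literal sums `hU`). [folklore] -/
theorem validΔ_of_litSP (d : OddConeRegionDataΔ) (TT : ITab3x5) (PL : IPieceL5) (L : List OddLit) (J : ℕ) (hl : d.l.Nodup)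
    (hlψ : d.lψ.Nodup) (hs : d.sizesOKS = true) (hcc : d.ccQ = 0)
    (hT : ∀ c m : ℕ, c < 5 → m < 2 → d.tabOKcS TT c m = true)
    (hP : ∀ c i : ℕ, c < 5 → i < 13 → d.kpieceOKcS PL c i = true) (hU : ∀ c : ℕ, c < 5 → d.ksumOKcS TT PL c = true)
    (hr : ∀ j : ℕ, j < J → d.rowLitOKL TT L j = true) :
    (⟨d.S, J, d.σ0, d.Wσ, d.ε0, d.Wε, L⟩ : OddHeadRowsΔ).ValidΔ d.cQ d.l d.ψQ d.lψ d.σlo d.σhi d.εlo d.εhi := by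
  simp only [OddConeRegionDataΔ.sizesOKS, OddConeRegionDataH.sizesOK, Bool.and_eq_true, decide_eq_true_eq] at hs
  obtain ⟨⟨⟨⟨⟨⟨⟨hsz, hσ⟩, hε⟩, hZ3⟩, hZ4⟩, hZ5⟩, hZψ0⟩, hZψt⟩ := hs
  obtain ⟨⟨⟨⟨⟨⟨⟨⟨hS, _⟩, _⟩, _⟩, _⟩, _⟩, _⟩, _⟩, _⟩ := hsz
  have hS : 0 < d.S := hS
  have hWσ : 0 ≤ d.Wσ := by unfold OddConeRegionDataΔ.Wσ; linarith
  have hWε : 0 ≤ d.Wε := by unfold OddConeRegionDataΔ.Wε; linarith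
  have hWb : 0 ≤ d.Wb := by unfold OddConeRegionDataΔ.Wb; linarith
  have hWt : 0 ≤ d.Wt := by unfold OddConeRegionDataΔ.Wt; linarith
  -- slots 0 and 1 (one Boolean each, as before)
  have t3₀ : tabOKS d.S (d.cQ 2) (-1) d.b0 d.Wb d.ccQ d.l TT.1 0 = true := hT 0 0 (by norm_num) (by norm_num)
  have t3₁ : tabOKS d.S (d.cQ 2) (-1) d.b0 d.Wb d.ccQ d.l TT.1 1 = true := hT 0 1 (by norm_num) (by norm_num)
  have t4₀ : tabOKS d.S (d.cQ 3) (-1) d.σ0 d.Wσ d.ccQ d.l TT.2.1 0 = true := hT 1 0 (by norm_num) (by norm_num)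
  have t4₁ : tabOKS d.S (d.cQ 3) (-1) d.σ0 d.Wσ d.ccQ d.l TT.2.1 1 = true := hT 1 1 (by norm_num) (by norm_num)
  have t5₀ : tabOKS d.S (d.cQ 4) 1 d.σ0 d.Wσ d.ccQ d.l TT.2.2.1 0 = true := hT 2 0 (by norm_num) (by norm_num)
  have t5₁ : tabOKS d.S (d.cQ 4) 1 d.σ0 d.Wσ d.ccQ d.l TT.2.2.1 1 = true := hT 2 1 (by norm_num) (by norm_num)
  have tψ0₀ : tabOKS d.S d.ψQ 0 0 0 d.ccQ d.lψ TT.2.2.2.1 0 = true := hT 3 0 (by norm_num) (by norm_num)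
  have tψ0₁ : tabOKS d.S d.ψQ 0 0 0 d.ccQ d.lψ TT.2.2.2.1 1 = true := hT 3 1 (by norm_num) (by norm_num)
  have tψt₀ : tabOKS d.S d.ψQ 0 d.t0 d.Wt d.ccQ d.lψ TT.2.2.2.2 0 = true := hT 4 0 (by norm_num) (by norm_num)
  have tψt₁ : tabOKS d.S d.ψQ 0 d.t0 d.Wt d.ccQ d.lψ TT.2.2.2.2 1 = true := hT 4 1 (by norm_num) (by norm_num)
  -- slot 2, piecewise (thirteen single-table pieces + one literal-only sum per component)
  have p3 : ∀ δ : ℝ, |δ| ≤ d.Wb → PMem2 d.S (deltaT2SR (d.cQ 2) (-1) d.b0 d.ccQ d.l δ) TT.1.2.2 :=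
    slot2_of_kpieces hS (d.cQ 2) (-1) d.b0 hWb d.ccQ d.l (fun i hi => hP 0 i (by norm_num) hi) (hU 0 (by norm_num))
  have p4 : ∀ δ : ℝ, |δ| ≤ d.Wσ → PMem2 d.S (deltaT2SR (d.cQ 3) (-1) d.σ0 d.ccQ d.l δ) TT.2.1.2.2 :=
    slot2_of_kpieces hS (d.cQ 3) (-1) d.σ0 hWσ d.ccQ d.l (fun i hi => hP 1 i (by norm_num) hi) (hU 1 (by norm_num))
  have p5 : ∀ δ : ℝ, |δ| ≤ d.Wσ → PMem2 d.S (deltaT2SR (d.cQ 4) 1 d.σ0 d.ccQ d.l δ) TT.2.2.1.2.2 :=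
    slot2_of_kpieces hS (d.cQ 4) 1 d.σ0 hWσ d.ccQ d.l (fun i hi => hP 2 i (by norm_num) hi) (hU 2 (by norm_num))
  have pψ0 : ∀ δ : ℝ, |δ| ≤ (0 : ℚ) → PMem2 d.S (deltaT2SR d.ψQ 0 0 d.ccQ d.lψ δ) TT.2.2.2.1.2.2 :=
    slot2_of_kpieces hS d.ψQ 0 0 le_rfl d.ccQ d.lψ (fun i hi => hP 3 i (by norm_num) hi) (hU 3 (by norm_num))
  have pψt : ∀ δ : ℝ, |δ| ≤ d.Wt → PMem2 d.S (deltaT2SR d.ψQ 0 d.t0 d.ccQ d.lψ δ) TT.2.2.2.2.2.2 :=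
    slot2_of_kpieces hS d.ψQ 0 d.t0 hWt d.ccQ d.lψ (fun i hi => hP 4 i (by norm_num) hi) (hU 4 (by norm_num))
  refine ⟨hS, hWσ, hWε, fun p hp => ?_⟩
  obtain ⟨h1, h2, h3, h4⟩ : (d.σlo : ℝ) ≤ p.1 ∧ p.1 ≤ d.σhi ∧ (d.εlo : ℝ) ≤ p.2 ∧ p.2 ≤ d.εhi := by
    simp only [Set.mem_prod, Set.mem_Icc] at hp; exact ⟨hp.1.1, hp.1.2, hp.2.1, hp.2.2⟩
  have hδσ : |p.1 - d.σ0| ≤ d.Wσ := by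
    unfold OddConeRegionDataΔ.σ0 OddConeRegionDataΔ.Wσ; push_cast; rw [abs_le]; constructor <;> linarith
  have hδε : |p.2 - d.ε0| ≤ d.Wε := by
    unfold OddConeRegionDataΔ.ε0 OddConeRegionDataΔ.Wε; push_cast; rw [abs_le]; constructor <;> linarith
  have hδb : |(p.1 + p.2) / 2 - d.b0| ≤ d.Wb := by
    unfold OddConeRegionDataΔ.b0 OddConeRegionDataΔ.Wb OddConeRegionDataΔ.σ0 OddConeRegionDataΔ.Wσ OddConeRegionDataΔ.ε0
      OddConeRegionDataΔ.Wε
    push_cast; rw [abs_le]; constructor <;> linarith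
  have hδt : |(p.1 - p.2) - d.t0| ≤ d.Wt := by
    unfold OddConeRegionDataΔ.t0 OddConeRegionDataΔ.Wt OddConeRegionDataΔ.σ0 OddConeRegionDataΔ.Wσ
      OddConeRegionDataΔ.ε0 OddConeRegionDataΔ.Wε
    push_cast; rw [abs_le]; constructor <;> linarith
  have hδ0 : |(0 : ℝ)| ≤ ((0 : ℚ) : ℝ) := by simp
  refine ⟨hδσ, hδε, fun j hj => ?_⟩
  have hcc' : ((d.ccQ : ℚ) : ℝ) = 0 := by rw [hcc]; push_cast; rfl
  -- q-sums as triples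
  have e3 := qSum_eq_delta_rowsS hS (d.cQ 2) (-1) d.b0 hWb d.ccQ hl hZ3 hδb
  have e4 := qSum_eq_delta_rowsS hS (d.cQ 3) (-1) d.σ0 hWσ d.ccQ hl hZ4 hδσ
  have e5 := qSum_eq_delta_rowsS hS (d.cQ 4) 1 d.σ0 hWσ d.ccQ hl hZ5 hδσ
  have eψ0 := qSum_eq_delta_rowsS hS d.ψQ 0 0 le_rfl d.ccQ hlψ hZψ0 hδ0
  have eψt := qSum_eq_delta_rowsS hS d.ψQ 0 d.t0 hWt d.ccQ hlψ hZψt hδt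
  have ab : ((d.b0 : ℚ) : ℝ) + ((p.1 + p.2) / 2 - d.b0) = (p.1 + p.2) / 2 := by ring
  have aσ : ((d.σ0 : ℚ) : ℝ) + (p.1 - d.σ0) = p.1 := by ring
  have a0 : (((0 : ℚ) : ℚ) : ℝ) + (0 : ℝ) = 0 := by simp
  have at' : ((d.t0 : ℚ) : ℝ) + ((p.1 - p.2) - d.t0) = p.1 - p.2 := by ring
  rw [ab] at e3; rw [aσ] at e4 e5; rw [a0] at eψ0; rw [at'] at eψt
  simp only [Rat.cast_neg, Rat.cast_one, Rat.cast_zero, hcc', sub_zero] at e3 e4 e5 eψ0 eψt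
  -- memberships in the triples from the literal tables (piecewise slot 2), then in the literal rows
  have q3 := pmem3_tripLSP hS (d.cQ 2) (-1) d.b0 d.ccQ d.l t3₀ t3₁ p3 d.N j hδb
  have q4 := pmem3_tripLSP hS (d.cQ 3) (-1) d.σ0 d.ccQ d.l t4₀ t4₁ p4 d.N j hδσ
  have q5 := pmem3_tripLSP hS (d.cQ 4) 1 d.σ0 d.ccQ d.l t5₀ t5₁ p5 d.N j hδσ
  have qψ0 := pmem3_tripLSP hS d.ψQ 0 0 d.ccQ d.lψ tψ0₀ tψ0₁ pψ0 d.N j hδ0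
  have qψt := pmem3_tripLSP hS d.ψQ 0 d.t0 d.ccQ d.lψ tψt₀ tψt₁ pψt d.N j hδt
  have hrow := hr j hj
  simp only [OddConeRegionDataΔ.rowLitOKL, OddConeRegionDataΔ.rowLitRowOK, Bool.and_eq_true] at hrow
  obtain ⟨⟨⟨⟨s3, s4⟩, s5⟩, sψ0⟩, sψt⟩ := hrow
  have m3 := pmem3_of_subset3 q3 s3
  have m4 := pmem3_of_subset3 q4 s4
  have m5 := pmem3_of_subset3 q5 s5
  have mψ0 := pmem3_of_subset3 qψ0 sψ0
  have mψt := pmem3_of_subset3 qψt sψt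
  refine ⟨⟨_, m3, fun E => ?_⟩, ⟨_, m4, fun E => ?_⟩, ⟨_, m5, fun E => ?_⟩, ⟨_, mψ0, fun E => ?_⟩, ⟨_, mψt, fun E => ?_⟩⟩
  · rw [e3 E j, show (⟨d.S, J, d.σ0, d.Wσ, d.ε0, d.Wε, L⟩ : OddHeadRowsΔ).b0 = d.b0 from rfl]; simp only [val3]
  · rw [e4 E j]; simp only [val3]
  · rw [e5 E j]; simp only [val3]
  · rw [eψ0 E j]; simp only [val3]
  · rw [eψt E j, show (⟨d.S, J, d.σ0, d.Wσ, d.ε0, d.Wε, L⟩ : OddHeadRowsΔ).t0 = d.t0 from rfl]; simp only [val3]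

end OddHeadRowsΔ

/-! ### Even sector -/

namespace EvenRegionDataΔ

variable (d : EvenRegionDataΔ)

/-- Containment of the computed kernel table `i` of component `c` in its literal (S-format, piecewise slot 2; ONE table per decision). [folklore] -/
def kpieceOKcS (PL : IPieceL4) (c i : ℕ) : Bool :=
  kpieceOKS d.S (d.compC c) (EvenRegionDataΔ.compσ c) (d.comps₀ c) (d.compW c) d.ccQ d.l (proj4 PL c) i

/-- Literal-only containment of component `c`: `combineS` of its thirteen literals ⊆ its slot-2 literal. [folklore] -/
def ksumOKcS (TT : ITab3 × ITab3 × ITab3 × ITab3) (PL : IPieceL4) (c : ℕ) : Bool := ksumOKS d.S (d.compW c) (proj4 PL c) (proj4 TT c)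

end EvenRegionDataΔ

namespace HeadRowsΔ

/-- **`ValidΔ` (even head rows) from literal δ-tables, S-format, PIECEWISE slot 2** (= `validΔ_of_litS` with the slot-2 containments
supplied as thirteen single-table pieces + literal-only sums). [folklore] -/
theorem validΔ_of_litSP (d : EvenRegionDataΔ) (TT : ITab3 × ITab3 × ITab3 × ITab3) (PL : IPieceL4)
    (L : List (ITriple × ITriple × ITriple)) (J : ℕ) (hl : d.l.Nodup) (hs : d.sizesOKS = true) (hcc : d.ccQ = 0)
    (hT : ∀ c m : ℕ, c < 4 → m < 2 → d.tabOKcS TT c m = true)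
    (hP : ∀ c i : ℕ, c < 4 → i < 13 → d.kpieceOKcS PL c i = true) (hU : ∀ c : ℕ, c < 4 → d.ksumOKcS TT PL c = true)
    (hr : ∀ j : ℕ, j < J → d.rowLitOKL TT L j = true) :
    (⟨d.S, J, d.σ0, d.Wσ, d.ε0, d.Wε, L⟩ : HeadRowsΔ).ValidΔ d.cQ d.l d.σlo d.σhi d.εlo d.εhi := by
  simp only [EvenRegionDataΔ.sizesOKS, EvenRegionDataH.sizesOK, Bool.and_eq_true, decide_eq_true_eq] at hs
  obtain ⟨⟨⟨⟨⟨⟨⟨⟨⟨⟨⟨⟨⟨⟨⟨⟨⟨hS, _⟩, _⟩, _⟩, _⟩, _⟩, _⟩, _⟩, _⟩, _⟩, _⟩, _⟩, hσ⟩, hε⟩,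
    hZX⟩, hZY⟩, hZ3⟩, hZ4⟩ := hs
  have hS : 0 < d.S := hS
  have hWσ : 0 ≤ d.Wσ := by unfold EvenRegionDataΔ.Wσ; linarith
  have hWε : 0 ≤ d.Wε := by unfold EvenRegionDataΔ.Wε; linarith
  have hWb : 0 ≤ d.Wb := by unfold EvenRegionDataΔ.Wb; linarith
  have tX₀ : tabOKS d.S (d.cQ 0) (-1) d.σ0 d.Wσ d.ccQ d.l TT.1 0 = true := hT 0 0 (by norm_num) (by norm_num)
  have tX₁ : tabOKS d.S (d.cQ 0) (-1) d.σ0 d.Wσ d.ccQ d.l TT.1 1 = true := hT 0 1 (by norm_num) (by norm_num)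
  have tY₀ : tabOKS d.S (d.cQ 1) (-1) d.ε0 d.Wε d.ccQ d.l TT.2.1 0 = true := hT 1 0 (by norm_num) (by norm_num)
  have tY₁ : tabOKS d.S (d.cQ 1) (-1) d.ε0 d.Wε d.ccQ d.l TT.2.1 1 = true := hT 1 1 (by norm_num) (by norm_num)
  have t3₀ : tabOKS d.S (d.cQ 3) (-1) d.b0 d.Wb d.ccQ d.l TT.2.2.1 0 = true := hT 2 0 (by norm_num) (by norm_num)
  have t3₁ : tabOKS d.S (d.cQ 3) (-1) d.b0 d.Wb d.ccQ d.l TT.2.2.1 1 = true := hT 2 1 (by norm_num) (by norm_num)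
  have t4₀ : tabOKS d.S (d.cQ 4) 1 d.b0 d.Wb d.ccQ d.l TT.2.2.2 0 = true := hT 3 0 (by norm_num) (by norm_num)
  have t4₁ : tabOKS d.S (d.cQ 4) 1 d.b0 d.Wb d.ccQ d.l TT.2.2.2 1 = true := hT 3 1 (by norm_num) (by norm_num)
  have pX : ∀ δ : ℝ, |δ| ≤ d.Wσ → PMem2 d.S (deltaT2SR (d.cQ 0) (-1) d.σ0 d.ccQ d.l δ) TT.1.2.2 :=
    slot2_of_kpieces hS (d.cQ 0) (-1) d.σ0 hWσ d.ccQ d.l (fun i hi => hP 0 i (by norm_num) hi) (hU 0 (by norm_num))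
  have pY : ∀ δ : ℝ, |δ| ≤ d.Wε → PMem2 d.S (deltaT2SR (d.cQ 1) (-1) d.ε0 d.ccQ d.l δ) TT.2.1.2.2 :=
    slot2_of_kpieces hS (d.cQ 1) (-1) d.ε0 hWε d.ccQ d.l (fun i hi => hP 1 i (by norm_num) hi) (hU 1 (by norm_num))
  have p3 : ∀ δ : ℝ, |δ| ≤ d.Wb → PMem2 d.S (deltaT2SR (d.cQ 3) (-1) d.b0 d.ccQ d.l δ) TT.2.2.1.2.2 :=
    slot2_of_kpieces hS (d.cQ 3) (-1) d.b0 hWb d.ccQ d.l (fun i hi => hP 2 i (by norm_num) hi) (hU 2 (by norm_num))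
  have p4 : ∀ δ : ℝ, |δ| ≤ d.Wb → PMem2 d.S (deltaT2SR (d.cQ 4) 1 d.b0 d.ccQ d.l δ) TT.2.2.2.2.2 :=
    slot2_of_kpieces hS (d.cQ 4) 1 d.b0 hWb d.ccQ d.l (fun i hi => hP 3 i (by norm_num) hi) (hU 3 (by norm_num))
  refine ⟨hS, hWσ, hWε, fun p hp => ?_⟩
  obtain ⟨h1, h2, h3, h4⟩ : (d.σlo : ℝ) ≤ p.1 ∧ p.1 ≤ d.σhi ∧ (d.εlo : ℝ) ≤ p.2 ∧ p.2 ≤ d.εhi := by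
    simp only [Set.mem_prod, Set.mem_Icc] at hp; exact ⟨hp.1.1, hp.1.2, hp.2.1, hp.2.2⟩
  have hδσ : |p.1 - d.σ0| ≤ d.Wσ := by
    unfold EvenRegionDataΔ.σ0 EvenRegionDataΔ.Wσ; push_cast; rw [abs_le]; constructor <;> linarith
  have hδε : |p.2 - d.ε0| ≤ d.Wε := by
    unfold EvenRegionDataΔ.ε0 EvenRegionDataΔ.Wε; push_cast; rw [abs_le]; constructor <;> linarith
  have hδb : |(p.1 + p.2) / 2 - d.b0| ≤ d.Wb := by
    unfold EvenRegionDataΔ.b0 EvenRegionDataΔ.Wb EvenRegionDataΔ.σ0 EvenRegionDataΔ.Wσ EvenRegionDataΔ.ε0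
      EvenRegionDataΔ.Wε
    push_cast; rw [abs_le]; constructor <;> linarith
  refine ⟨hδσ, hδε, fun j hj => ?_⟩
  have hcc' : ((d.ccQ : ℚ) : ℝ) = 0 := by rw [hcc]; push_cast; rfl
  have eX := qSum_eq_delta_rowsS hS (d.cQ 0) (-1) d.σ0 hWσ d.ccQ hl hZX hδσ
  have eY := qSum_eq_delta_rowsS hS (d.cQ 1) (-1) d.ε0 hWε d.ccQ hl hZY hδε
  have eZ3 := qSum_eq_delta_rowsS hS (d.cQ 3) (-1) d.b0 hWb d.ccQ hl hZ3 hδb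
  have eZ4 := qSum_eq_delta_rowsS hS (d.cQ 4) 1 d.b0 hWb d.ccQ hl hZ4 hδb
  have aσ : ((d.σ0 : ℚ) : ℝ) + (p.1 - d.σ0) = p.1 := by ring
  have aε : ((d.ε0 : ℚ) : ℝ) + (p.2 - d.ε0) = p.2 := by ring
  have ab : ((d.b0 : ℚ) : ℝ) + ((p.1 + p.2) / 2 - d.b0) = (p.1 + p.2) / 2 := by ring
  rw [aσ] at eX; rw [aε] at eY; rw [ab] at eZ3 eZ4
  simp only [Rat.cast_neg, Rat.cast_one, hcc', sub_zero] at eX eY eZ3 eZ4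
  have qX := pmem3_tripLSP hS (d.cQ 0) (-1) d.σ0 d.ccQ d.l tX₀ tX₁ pX d.N j hδσ
  have qY := pmem3_tripLSP hS (d.cQ 1) (-1) d.ε0 d.ccQ d.l tY₀ tY₁ pY d.N j hδε
  have q3 := pmem3_tripLSP hS (d.cQ 3) (-1) d.b0 d.ccQ d.l t3₀ t3₁ p3 d.N j hδb
  have q4 := pmem3_tripLSP hS (d.cQ 4) 1 d.b0 d.ccQ d.l t4₀ t4₁ p4 d.N j hδb
  have qZ := pmem3_add q3 q4
  have hrow := hr j hj
  simp only [EvenRegionDataΔ.rowLitOKL, EvenRegionDataΔ.rowLitRowOK, Bool.and_eq_true] at hrow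
  obtain ⟨⟨sX, sY⟩, sZ⟩ := hrow
  have mX := pmem3_of_subset3 qX sX
  have mY := pmem3_of_subset3 qY sY
  have mZ := pmem3_of_subset3 qZ sZ
  refine ⟨⟨_, mX, fun E => ?_⟩, ⟨_, mY, fun E => ?_⟩, ⟨_, mZ, fun E => ?_⟩⟩
  · rw [eX E j]; simp only [val3]
  · rw [eY E j]; simp only [val3]
  · rw [eZ3 E j, eZ4 E j, show (⟨d.S, J, d.σ0, d.Wσ, d.ε0, d.Wε, L⟩ : HeadRowsΔ).b0 = d.b0 from rfl]
    simp only [val3, evalR_addR]; ring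

end HeadRowsΔ

end Summit.CriticalPhenomena.Ising3D
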